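import Literature.AnabelianGeometry.AbsoluteAnabelian.FreeProcyclicModel
import HarnessLib

/-!
# [AbsTopII] Prop. 1.3 (i) p. 11, "`≅ Ẑ^Σ` as abstract profinite groups": a VOCABULARY predicate whose
# universal closure is false (proof-only companion of `AbsTopII/InertiaGroups.lean`)

S. Mochizuki, *Topics in Absolute Anabelian Geometry II: Decomposition Groups and Endomorphisms*,
J. Math. Sci. Univ. Tokyo **20** (2013) [AbsTopII] §1, Prop. 1.3 (i), kurims text p. 11
[cite: MochizukiAbsTopII2013, Prop 1.3 (i) p.11]:

> "(i) `Π` […] is slim. Every edge-like subgroup of `H` is commensurably terminal and isomorphic to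
> `Ẑ^Σ`, as an abstract profinite group."

The declaration `AbsTopII.IsFreeProSigmaCyclic S G` (`AbsTopII/InertiaGroups.lean`, seat abc-iut-L4-t6)
is the intrinsic typing of the PHRASE "`G ≅ Ẑ^Σ` as an abstract profinite group" (a dense cyclic subgroup;
the indices of open subgroups are exactly the `Σ`-integers) — a DEFINITION with parameters `S`, `G`, whose
docstring carries the page locator, so the cell's frozen FACT-LIST (row F-2418; class `preparatory`,
kernel_closedness `parametrised`, label «model-witness» by the model theorem
`isFreeProSigmaCyclic_padicProdOn`) lists it among the bindable "published prerequisites".  A predicate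
is not a claim: its universal closure says "EVERY topological group is free pro-`Σ`-cyclic for EVERY `Σ`",
and is false.  This PROOF-ONLY file (abc-iut cell, block C / W6, seat abc-iut-w6-d028, C3 default =
FACT-LIST proving; no definition, no instance) records the kernel negation of the universal closure over
exactly the declaration's binders (universe level `0`) from a minimal closed witness, and cites BY NAME
the theorems of the tree in which the predicate is ESTABLISHED for the groups print applies it to:

* F-2418 `AbsTopII.IsFreeProSigmaCyclic` — `not_forall_isFreeProSigmaCyclic`: the trivial group `PUnit`
  is not free pro-`{2}`-cyclic: `2` is a `{2}`-integer, but the only subgroup of `PUnit` is `⊤`, of index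
  `1 ≠ 2` (`not_isFreeProSigmaCyclic_two_punit`; the same computation for `⊥ ≤ H_*` is
  abc-iut's `not_isFreeProSigmaCyclic_singleton_of_subsingleton`, `AbsTopIChainsSchemaClosures.lean`).
  Established instances: `Ẑ^Σ = ∏_{p ∈ Σ} ℤ_p` IS free pro-`Σ`-cyclic for every `Σ`
  (`isFreeProSigmaCyclic_padicProdOn`, seat abc-iut-w5-d231's model witness) and `ℤ_l` is free
  pro-`{l}`-cyclic (`isFreeProSigmaCyclic_singleton_padicInt`), file `FreeProcyclicModel.lean`; the
  abstract characterisation `IsFreeProSigmaCyclic {l} G ↔ G ≃ₜ* ℤ_l` is `FreeProcyclicCharacterization.lean`.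

So the row is not an admissible HYPOTHESIS of anything (a consumer needing "`I ≅ Ẑ^Σ`" for a specific
inertia group `I` proves it, or carries it as the printed hypothesis of Prop. 1.3 (i) at that `I`);
FACT-LIST class «universal-closure REFUTED; instance forms PROVED».  Elementary; nothing here bears on
[IUTchIII] Cor. 3.12 or takes a side; refuted-as-closure is a statement about OUR typing's binders, not
about the paper.
-/

namespace Literature.AnabelianGeometry.AbsoluteAnabelian

open Literature.AnabelianGeometry.Anabelioids (IsSigmaInteger)

universe u

/-! ### The closed witness: the trivial group and `Σ = {2}` ([AbsTopII] Prop. 1.3 (i) p. 11) -/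

/-- `2` is a `{2}`-integer (positive, all prime factors in `{2}`). [cite: MochizukiAbsTopII2013, Ex 1.1 (i) p.8] -/
theorem isSigmaInteger_two_singleton_two : IsSigmaInteger ({2} : Set ℕ) 2 :=
  ⟨two_pos, fun _ hp hp2 => Set.mem_singleton_iff.2 ((Nat.prime_dvd_prime_iff_eq hp Nat.prime_two).1 hp2)⟩

/-- In a group with one element every subgroup has index `1`. [cite: MochizukiAbsTopII2013, Prop 1.3 (i) p.11] -/
theorem index_eq_one_of_subsingleton {G : Type u} [Group G] [Subsingleton G] (H : Subgroup G) :
    H.index = 1 := by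
  have htop : H = ⊤ := eq_top_iff.2 fun x _ => by
    rw [Subsingleton.elim x 1]
    exact H.one_mem
  rw [htop, Subgroup.index_top]

/-- **Closed witness**: the trivial (topological) group `PUnit` is NOT "`≅ Ẑ^{{2}}` as an abstract
profinite group" — `2` is a `{2}`-integer, yet no subgroup of `PUnit` has index `2` (all have index `1`).
[cite: MochizukiAbsTopII2013, Prop 1.3 (i) p.11] -/
theorem not_isFreeProSigmaCyclic_two_punit :
    ¬ AbsTopII.IsFreeProSigmaCyclic ({2} : Set ℕ) PUnit.{1} := by
  intro h
  obtain ⟨H, -, hH⟩ := (h.isOpen_index_iff 2).2 isSigmaInteger_two_singleton_two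
  rw [index_eq_one_of_subsingleton H] at hH
  omega

/-- More generally, NO group with one element is free pro-`Σ`-cyclic for a `Σ` containing a prime `l`
(`l` is then a `Σ`-integer of which no subgroup has index). [cite: MochizukiAbsTopII2013, Prop 1.3 (i) p.11] -/
theorem not_isFreeProSigmaCyclic_of_subsingleton_of_prime_mem {S : Set ℕ} {l : ℕ} (hl : l.Prime)
    (hlS : l ∈ S) {G : Type u} [Group G] [TopologicalSpace G] [Subsingleton G] :
    ¬ AbsTopII.IsFreeProSigmaCyclic S G := by
  intro h
  have hS : IsSigmaInteger S l :=
    ⟨hl.pos, fun _ hp hpl => ((Nat.prime_dvd_prime_iff_eq hp hl).1 hpl).symm ▸ hlS⟩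
  obtain ⟨H, -, hH⟩ := (h.isOpen_index_iff l).2 hS
  rw [index_eq_one_of_subsingleton H] at hH
  exact hl.one_lt.ne hH

/-! ### F-2418 `AbsTopII.IsFreeProSigmaCyclic` ([AbsTopII] Prop. 1.3 (i) p. 11): the universal closure is false -/

/-- **The universal closure of the vocabulary predicate `AbsTopII.IsFreeProSigmaCyclic` is FALSE**
(FACT-LIST F-2418: a definition, not a hypothesis).  Binders exactly those of the declaration, universe
level `0`; witness `Σ = {2}`, `G = PUnit`. [cite: MochizukiAbsTopII2013, Prop 1.3 (i) p.11] -/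
theorem not_forall_isFreeProSigmaCyclic :
    ¬ ∀ (S : Set ℕ) (G : Type) [Group G] [TopologicalSpace G],
        Literature.AnabelianGeometry.AbsoluteAnabelian.AbsTopII.IsFreeProSigmaCyclic S G :=
  fun h => not_isFreeProSigmaCyclic_two_punit (h {2} PUnit)

/-- Even with the set of primes FIXED to any `Σ` containing a prime, "every topological group is free
pro-`Σ`-cyclic" is false (same witness). [cite: MochizukiAbsTopII2013, Prop 1.3 (i) p.11] -/
theorem not_forall_isFreeProSigmaCyclic_of_prime_mem {S : Set ℕ} {l : ℕ} (hl : l.Prime) (hlS : l ∈ S) :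
    ¬ ∀ (G : Type) [Group G] [TopologicalSpace G],
        Literature.AnabelianGeometry.AbsoluteAnabelian.AbsTopII.IsFreeProSigmaCyclic S G :=
  fun h => not_isFreeProSigmaCyclic_of_subsingleton_of_prime_mem hl hlS (G := PUnit) (h PUnit)

/-- **Census of F-2418**: the closure is false, while the intended models satisfy the predicate —
`Ẑ^Σ = ∏_{p ∈ Σ} ℤ_p` for EVERY `Σ` (`isFreeProSigmaCyclic_padicProdOn`) and `ℤ_l` for `Σ = {l}`
(`isFreeProSigmaCyclic_singleton_padicInt`) — the instance form in which [AbsTopII] Prop. 1.3 (i) uses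
the phrase. [cite: MochizukiAbsTopII2013, Prop 1.3 (i) p.11] -/
theorem isFreeProSigmaCyclic_schema_census (S : Set ℕ) (l : ℕ) [Fact l.Prime] :
    (¬ ∀ (S : Set ℕ) (G : Type) [Group G] [TopologicalSpace G],
        Literature.AnabelianGeometry.AbsoluteAnabelian.AbsTopII.IsFreeProSigmaCyclic S G) ∧
      AbsTopII.IsFreeProSigmaCyclic S
        (Multiplicative (∀ p : {p : Nat.Primes // (p : ℕ) ∈ S}, @PadicInt (p.1 : ℕ) ⟨p.1.2⟩)) ∧
      AbsTopII.IsFreeProSigmaCyclic {l} (Multiplicative ℤ_[l]) :=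
  ⟨not_forall_isFreeProSigmaCyclic, isFreeProSigmaCyclic_padicProdOn S,
    isFreeProSigmaCyclic_singleton_padicInt l⟩

end Literature.AnabelianGeometry.AbsoluteAnabelian
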